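/-
Copyright: lit-balaban Phase-2 proof seat p30 (gen 9).  Statement-level skeleton of a published paper; no proof claims beyond what
the kernel checks below.
-/
import Literature.MathematicalPhysics.QuantumFieldTheory.BalabanImbrieJaffe1984to88.BIJ85Prop12TorusBridgeHolder
import Literature.MathematicalPhysics.QuantumFieldTheory.Balaban1983to89.B5Prop12GHolds

/-!
# [BalabanImbrieJaffe1985] (7.2.2) ⇐ [6I] Prop. 1.2 — [6I] PROPOSITION 1.2 FOR p09's TORUS CARRIER, HYPOTHESIS-FREE (file 5 of 5)

T. Bałaban, J. Imbrie, A. Jaffe, Commun. Math. Phys. **97** (1985) 299–329 [BalabanImbrieJaffe1985], Sect. 7.2 p. 325: *"This inequality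
is a consequence of Proposition 1.2 and the representation (1.103) of [6I]"*; T. Bałaban, Commun. Math. Phys. **95** (1984) 17–40
[Balaban1984PropagatorsI] = [6I], Proposition 1.2 pp. 35–36.

THE KNITTING (rows B5.Prop1.2 → C1.Eq7.2.1-7.2.2 / C1.Eq7.2.4 / C1.Eq7.3.1-7.3.2 / C2.Eq2.16–2.19 of the lit-balaban skeleton).  Row B5.Prop1.2
is PROVED on the tori of record: p37's `B5Prop12GHolds.prop12_famG_printed (hd : 1 ≤ d) (hL : Odd L ∧ 1 < L) (ha : 0 < a) :
B5.Prop12Printed (B5Prop12GLattice.famG d L a)`, the family of r02's real settings `latticeSettingP12R (L^K) (2L^m, …) a K` over all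
`P : Params` with `P.d = d`, `P.L = L`, `1 ≤ P.K` (`B5ResidualGpTorusHolds.TopIdx`).  The torus theorems of Sect. 7 «given only [6I]
Prop. 1.2 by name» consume p09's family `fun j => settingOf (torusRep P (lev j) (deltaAData (hlev j) a)) j` instead.  Here:
* §1 THE INDEX SURGERY: the scale `k` of the torus of `P` (`1 ≤ k ≤ m + K`) is the TOP scale of the parameter set
  `scaleParams P k = ⟨d, L, m + K − k, k⟩`, and r02's setting of that index IS `latticeSettingP12R (L^k) (Mk P k) a k` — definitionally
  (`famG_scaleIdx`: `nP = L^k`, `MP = Mk P k = (2L^{m+K−k}, …)`);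
* §2 `prop12Printed_torus_of_famG`: [6I] Prop. 1.2 for r02's family ⇒ [6I] Prop. 1.2 for p09's family at every choice of scales
  `1 ≤ lev j ≤ m + K` (`BIJ85Prop12TorusBridgeHolder.ineq110_114_transfer`, constants `(6^d e^{3δ₀}C, 36^d e^{4δ₀}(Lw(d)+1)max(C_α,0), 0, 0, δ₀)` uniform in `j`),
  and **`prop12Printed_torus`**: the same HYPOTHESIS-FREE (odd `L > 1` and `d ≥ 1` are fields of `Params`);
* §3 the first consumer made hypothesis-free: row C1.Eq7.2.1-7.2.2's typed (7.2.2) `KernelData.Ineq722` for the printed operators on the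
  torus (`ineq722_deltaA`, from p09's `BIJ85Ineq722DeltaA.ineq722_deltaA_of_prop12Printed`); the other consumers (p08's (2.17)/(7.2.4),
  p30's `BIJ85ResidualSupBound.closedIdx_total_of_prop12Printed`) instantiate the same way with `prop12Printed_torus`.
HONEST SCOPE.  Scales `k ≥ 1` only (r02's family has `K ≥ 1`; the scale `k = 0`, `Q_0 = id`, has no consumer); the canonical
indexing `levPos P j = max 1 (min j (m+K))` needs `1 ≤ m + K`.  statement-level skeleton of published theorems with citation tags;
proofs where landed; nothing here is a claim about the Yang–Mills mass gap.  Unit `lit-balaban-p30` (literature-prover-lit-balaban-p30-g9-0),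
2026-08-21.
-/

open scoped BigOperators

namespace Literature.MathematicalPhysics.QuantumFieldTheory.BalabanImbrieJaffe1984to88.BIJ85Prop12TorusBridge

open Balaban1983to89 hiding Site Plaq
open Balaban1983to89.B5Eq117TorusCarriers (Mk)
open Balaban1983to89.B5CoverP12Lattice (Lw Lw_nonneg)
open Balaban1983to89.B5SettingP12Real (latticeSettingP12R)
open Balaban1983to89.B5Prop12GLattice (famG)
open Balaban1983to89.B5ResidualGpTorusHolds (TopIdx)
open Balaban1983to89.B5Prop12GHolds (prop12_famG_printed)
open Balaban1983to89.B5SiteBridgeP12 (nP MP)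
open BIJ85Ineq722Proof BIJ85Ineq722ProofPart2 BIJ85Ineq722Torus BIJ85Ineq722DeltaA BIJ85Sect7Statements
open BIJ85Prop12TorusBridgeHolder (ineq110_114_transfer)
-- inside this namespace the bare `Site` is the `ℤ^d` carrier of the QFT root; the torus one is renamed:
open Balaban1983to89 renaming Site → TSite

noncomputable section

variable {P : Params} {k : ℕ}

/-! ## §1  The index surgery -/

/-- **the parameter set whose TOP scale is the scale `k` of `P`**: `⟨d, L, m + K − k, k⟩` (same `d`, `L`; `m′ + K′ = m + K` for
`k ≤ m + K`, so the tori `T^{(k)}`, `T^{(0)}` of `P` are the tori `T^{(K′)}`, `T^{(0)}` of `scaleParams P k`).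
[cite: Balaban1984PropagatorsI, p.35 («T_η … ε = L^{−K}»)] -/
def scaleParams (P : Params) (k : ℕ) : Params := ⟨P.d, P.L, P.m + P.K - k, k, P.hd, P.hL⟩

/-- the index of r02's family of record at scale `k ≥ 1` of `P`. [cite: Balaban1984PropagatorsI, Prop. 1.2 p.35] -/
def scaleIdx (P : Params) {k : ℕ} (hk1 : 1 ≤ k) : TopIdx P.d P.L := ⟨scaleParams P k, rfl, rfl, hk1⟩

/-- `n = L^k` for the surgery index. [cite: Balaban1984PropagatorsI, p.35] -/
theorem nP_scaleParams (P : Params) (k : ℕ) : nP (scaleParams P k) = P.L ^ k := rfl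

/-- `M = Mk P k = (2L^{m+K−k}, …)` for the surgery index. [cite: Balaban1984PropagatorsI, (1.6) p.18] -/
theorem MP_scaleParams (P : Params) (k : ℕ) : MP (scaleParams P k) = Mk P k := rfl

/-- **r02's setting of record at the surgery index IS the setting at scale `k` of `P`** (definitionally).
[cite: Balaban1984PropagatorsI, Prop. 1.2 (1.110)–(1.114) pp.35–36] -/
theorem famG_scaleIdx (a : ℝ) (hk1 : 1 ≤ k) : famG P.d P.L a (scaleIdx P hk1) = latticeSettingP12R (P.L ^ k) (Mk P k) a k := rfl

/-! ## §2  [6I] Proposition 1.2 for p09's torus family -/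

/-- **[6I] PROP. 1.2 FOR r02's FAMILY ⇒ [6I] PROP. 1.2 FOR p09's TORUS FAMILY** (scales `1 ≤ lev j ≤ m + K`; constants
`(6^d e^{3δ₀}C, 36^d e^{4δ₀}(Lw(d)+1)max(C_α,0), 0, 0, δ₀)` from those of the hypothesis, uniform in `j`).
[cite: Balaban1984PropagatorsI, Prop. 1.2 (1.110)–(1.114) pp.35–36] -/
theorem prop12Printed_torus_of_famG {lev : ℕ → ℕ} (hlev : ∀ j, lev j ≤ P.m + P.K) (hlev1 : ∀ j, 1 ≤ lev j) (a : ℝ)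
    (hG : B5.Prop12Printed (famG P.d P.L a)) :
    B5.Prop12Printed (fun j => settingOf (torusRep P (lev j) (deltaAData (hlev j) a)) j) := by
  obtain ⟨δ₀, C, Cα, Cε, Cαε, hδ, hC, hall⟩ := hG
  refine ⟨δ₀, 6 ^ P.d * Real.exp (3 * δ₀) * C, fun α => 36 ^ P.d * Real.exp (4 * δ₀) * (Lw P.d + 1) * max (Cα α) 0,
    fun _ => 0, fun _ _ => 0, hδ, by positivity, fun j => ?_⟩
  exact ineq110_114_transfer (hlev j) a hC.le hδ.le (lev j) j (hall (scaleIdx P (hlev1 j)))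

/-- **[6I] PROPOSITION 1.2 FOR p09's TORUS CARRIER, HYPOTHESIS-FREE**: for every parameter set `P` of `Setup` (odd `L > 1`, `d ≥ 1`),
every `a > 0` and every choice of scales `1 ≤ lev j ≤ m + K`, `B5.Prop12Printed (fun j => settingOf (torusRep P (lev j) (deltaAData (hlev j)
a)) j)` — p37's `prop12_famG_printed` through the surgery and the transfer. [cite: Balaban1984PropagatorsI, Prop. 1.2 (1.110)–(1.114) pp.35–36] -/
theorem prop12Printed_torus {lev : ℕ → ℕ} (hlev : ∀ j, lev j ≤ P.m + P.K) (hlev1 : ∀ j, 1 ≤ lev j) {a : ℝ} (ha : 0 < a) :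
    B5.Prop12Printed (fun j => settingOf (torusRep P (lev j) (deltaAData (hlev j) a)) j) :=
  prop12Printed_torus_of_famG hlev hlev1 a (prop12_famG_printed P.hd P.hL ha)

/-- the canonical indexing of the POSITIVE standing range: `j ↦ max 1 (min j (m + K))` (the scales `1, …, m + K`).
[cite: Balaban1987RG1, (0.1) p.251] -/
def levPos (P : Params) (j : ℕ) : ℕ := max 1 (levStd P j)

/-- `levPos j ≤ m + K` when `1 ≤ m + K`. [cite: Balaban1987RG1, (0.1) p.251] -/
theorem levPos_le (hmK : 1 ≤ P.m + P.K) (j : ℕ) : levPos P j ≤ P.m + P.K :=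
  max_le hmK (levStd_le j)

/-- `1 ≤ levPos j`. [cite: Balaban1987RG1, (0.1) p.251] -/
theorem one_le_levPos (j : ℕ) : 1 ≤ levPos P j := le_max_left _ _

/-- every scale `1 ≤ k ≤ m + K` occurs: `levPos k = k`. [cite: Balaban1987RG1, (0.1) p.251] -/
theorem levPos_eq (hk1 : 1 ≤ k) (hk : k ≤ P.m + P.K) : levPos P k = k := by
  unfold levPos levStd
  rw [min_eq_left hk, max_eq_right hk1]

/-- **[6I] Prop. 1.2 on the canonical positive range of scales, hypothesis-free.** [cite: Balaban1984PropagatorsI, Prop. 1.2 pp.35–36] -/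
theorem prop12Printed_torus_levPos (hmK : 1 ≤ P.m + P.K) {a : ℝ} (ha : 0 < a) :
    B5.Prop12Printed (fun j => settingOf (torusRep P (levPos P j) (deltaAData (levPos_le hmK j) a)) j) :=
  prop12Printed_torus (levPos_le hmK) one_le_levPos ha

/-! ## §3  First consumers, hypothesis-free -/

/-- **ROW C1.Eq7.2.1-7.2.2 ON THE TORUS FOR THE PRINTED OPERATORS, HYPOTHESIS-FREE**: r15's typed (7.2.2) `KernelData.Ineq722` for p09's
torus kernel family `j ↦ torusKernelData P (lev j) (deltaAData …) …` (`H_k = G_kQ_k^*(Q_kG_kQ_k^*)⁻¹`, `G_k = Δ_a⁻¹`) at every choice of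
scales `1 ≤ lev j ≤ m + K` — p09's `ineq722_deltaA_of_prop12Printed` fed with `prop12Printed_torus`. [cite: BalabanImbrieJaffe1985, (7.2.2) p.325] -/
theorem ineq722_deltaA {lev : ℕ → ℕ} (hlev : ∀ j, lev j ≤ P.m + P.K) (hlev1 : ∀ j, 1 ≤ lev j) {a : ℝ} (ha : 0 < a)
    (BondU : ℕ → Type) (distEB : (j : ℕ) → TSite P 0 → BondU j → ℝ)
    (Cker : (j : ℕ) → Fin P.d → Fin P.d → TSite P (lev j) → TSite P (lev j) → ℝ) (Dker : (j : ℕ) → TSite P 0 → BondU j → ℝ) :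
    KernelData.Ineq722 (fun j => torusKernelData P (lev j) (deltaAData (hlev j) a) (BondU j) (distEB j) (Cker j) (Dker j)) :=
  ineq722_deltaA_of_prop12Printed lev hlev ha BondU distEB Cker Dker (prop12Printed_torus hlev hlev1 ha)

end

end Literature.MathematicalPhysics.QuantumFieldTheory.BalabanImbrieJaffe1984to88.BIJ85Prop12TorusBridge
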